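import Summits.PneNP.PneNP.Theses.ExpanderLinearGenerators
import Summits.PneNP.PneNP.Theorems.ExpanderLinearGeneratorsLinearGeneratorResolutionSize
import Literature.Computability.MetaComplexity.ResolutionTreeLikeSizeWidth
import Literature.Computability.MetaComplexity.LinearMapResolutionWidthProofs

/-!
# PneNP / ExpanderLinearGenerators — the expansion-scale law holds for tree-like resolution,
uniformly in the instance (stmt-PneNP-11442, calibration rung)

Route `PneNP/ExpanderLinearGenerators`, crux stmt-PneNP-11442
(`Summit.PneNP.PneNP.Theses.ExpanderLinearGenerators.ExpansionForcesDepthFregeSize`: an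
`ℓ`-sparse system over `𝔽₂` whose row supports form an `(r, 3/4 · ℓ)`-boundary expander forces
depth-`d` Frege refutations of size `2^{r^ε}`, for ANY numbers `n, m` of variables and rows). The
route's resolution rung (`ExpanderXorResWidth`, proved) is a WIDTH bound `≥ r/4`; the dag-like size
bound that follows from it by Ben-Sasson–Wigderson, `2^{Ω((r/4 - ℓ)²/n)}`, degenerates when
`n ≫ r²` — exactly the "uniform in `n, m`" regime the crux insists on. This file records that for
TREE-LIKE resolution the law holds uniformly, with a linear (not `r^ε`) exponent:

* `expanderXor_treeLike_length_ge` — every tree-like resolution refutation of `sumEncoding 1 E`,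
  for an `ℓ`-sparse (`ℓ ≥ 1`) system `E` whose row supports form an `(r, 3/4 · ℓ)`-boundary
  expander (`r ≥ 2`), has at least `2^{3ℓr/8 - ℓ}` lines — whatever `n` and `m` are.

Proof: the clause width bound `card_le_of_mem_clauseSet_sumEncoding_one` (sibling file
`…LinearGeneratorResolutionSize`, the dag-like rung), the row-level Ben-Sasson–Wigderson invariant
(`Literature.Computability.MetaComplexity.not_resDerivable_empty_of_rows`: no refutation of width
`< 3ℓr/8`) and the tree-like size–width relation
(`Literature.Computability.MetaComplexity.resDerivable_of_isTreeLike`, BSW Thm 3.3: a tree-like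
refutation with `S` lines yields one of width `≤ ℓ + ⌊log₂ S⌋`).

References: E. Ben-Sasson, A. Wigderson, J. ACM 48 (2001), Thm 3.3, Thm 4.4 / §5
[BenSassonWigderson2001]; J. Krajíček, *Proof complexity* (CUP 2019), Lemma 13.4.5, Cor. 13.4.6
[KrajicekProofComplexity2019].
-/

namespace Summit.PneNP.PneNP.Theorems

set_option linter.dupNamespace false -- `Summit.PneNP.PneNP.…`: summit = sub-problem (D-0017)

open Literature.Computability.MetaComplexity Literature.Computability.Complexity

/-- **The expansion-scale law for tree-like resolution, uniform in the instance.** For `ℓ ≥ 1`,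
`r ≥ 2` and every system `E` of `m` equations over `𝔽₂` in `n` unknowns with supports of size
`≤ ℓ` forming an `(r, 3/4 · ℓ)`-boundary expander, every TREE-LIKE resolution refutation `π` of
`sumEncoding 1 E` has `2^{3ℓr/8 - ℓ} ≤ |π|`. (A tree-like refutation with `S` lines gives a
refutation of width `≤ ℓ + ⌊log₂ S⌋` by BSW Thm 3.3, and no refutation has width `< 3ℓr/8` by
the row-level width invariant; unsolvability is not assumed — without it there is no `π`.)
[cite: BenSassonWigderson2001, Theorem 3.3 and Theorem 4.4] -/
theorem expanderXor_treeLike_length_ge :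
    ∀ (ℓ : ℕ) (r : ℝ) (n m : ℕ) (E : Fin m → LinEqMod 2 n), 1 ≤ ℓ → 2 ≤ r →
      (∀ i, (E i).supp.card ≤ ℓ) →
      IsBoundaryExpander (fun i => (E i).supp.map Fin.valEmbedding) r (3 / 4 * ℓ) →
      ∀ π : List (ResLine ℕ), IsResRefutation (sumEncoding 1 E) π → IsTreeLike π →
        (2 : ℝ) ^ (3 / 8 * ℓ * r - ℓ) ≤ (π.length : ℝ) := by
  intro ℓ r n m E hℓ hr hsparse hexp π hπ htree
  have hW : ∀ D ∈ clauseSet (sumEncoding 1 E), D.card ≤ ℓ := fun D hD =>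
    card_le_of_mem_clauseSet_sumEncoding_one E hsparse hD
  have hD := resDerivable_of_isTreeLike hπ htree hW
  have h1 : (1 : ℝ) ≤ ℓ := by exact_mod_cast hℓ
  have hc : (0 : ℝ) < 3 / 4 * ℓ := by linarith
  -- the width of the produced refutation is at least `3ℓr/8`
  have hwidth : 3 / 4 * (ℓ : ℝ) * r / 2 ≤ (ℓ + Nat.log 2 π.length : ℕ) := by
    by_contra hlt
    push Not at hlt
    exact not_resDerivable_empty_of_rows E hexp hc hr hlt hD
  push_cast at hwidth
  have hlog : 3 / 8 * (ℓ : ℝ) * r - ℓ ≤ (Nat.log 2 π.length : ℝ) := by linarith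
  -- and `2^{⌊log₂ S⌋} ≤ S`
  have hpos : π.length ≠ 0 := by
    obtain ⟨-, l, hl, -⟩ := hπ
    exact (List.ne_nil_iff_length_pos.1 (List.ne_nil_of_mem hl)).ne'
  have hpow : ((2 ^ Nat.log 2 π.length : ℕ) : ℝ) ≤ (π.length : ℝ) := by
    exact_mod_cast Nat.pow_log_le_self 2 hpos
  calc (2 : ℝ) ^ (3 / 8 * (ℓ : ℝ) * r - ℓ) ≤ (2 : ℝ) ^ ((Nat.log 2 π.length : ℕ) : ℝ) :=
        Real.rpow_le_rpow_of_exponent_le (by norm_num) hlog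
    _ = ((2 ^ Nat.log 2 π.length : ℕ) : ℝ) := by
        rw [Real.rpow_natCast]; push_cast; ring
    _ ≤ (π.length : ℝ) := hpow

end Summit.PneNP.PneNP.Theorems
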